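import Summits.CriticalPhenomena.PercolationContinuityZ3.Theorems.PercNearOneGluingNoHeavyLowerTailSunflowerMultiPetalTileCore
import Summits.CriticalPhenomena.PercolationContinuityZ3.Theorems.PercNearOneGluingNoHeavyLowerTailSunflowerMultiPetalLeFive
import HarnessLib
import HarnessLib.Audit

/-!
# `NoHeavyLowerTail` (crux stmt-CriticalPhenomena-4575), abstract sunflower cubic, `k` petals: ★ₖ for every structure whose NON-BOTTOM-MODULE CORE has at most five points

Support file (seat `prim-l12-p2` gen 33; `--supports stmt-CriticalPhenomena-4575`; companion of `…SunflowerMultiPetalTileCore` (this gen: core reduction `gsum_core_biUnion_nonneg_of_modules`)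
and `…SunflowerMultiPetalLeFive` (p368808: ★ₖ on every sub-cube with ≤ 5 points, `ZKW_nonneg_of_card_le_five`)).  Everything here is PROVED; no `sorry`.
Memo: run/shared/lean/prim/prim-l12/prim-l12-p2/FINDING-g33-MODULE-LIFT.md §1.11.

* `gsum_empty_glue_eq_ZKW` : `gsum W ∅ ∅ ∅ = ZKW W` (the two encodings of the ordered 3-partitions of `W`).
* **`ZK_nonneg_of_modules_core_card_le_five`**: if `univ = W₀ ⊔ ⨆ M i` with pairwise disjoint modules `M i`, `lab (M i) ≠ 0`, and `#W₀ ≤ 5`, then `0 ≤ ZK` — ★ₖ for every structure that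
  is a θ_m-type blow-up 'plus at most five wild coordinates' (every `k`, every `m`).
-/

namespace Summit.CriticalPhenomena.PercolationContinuityZ3.Theorems.SunflowerPartition

open Finset

variable {α : Type*} [DecidableEq α]

namespace MSunflower

variable {k : ℕ} (F : MSunflower k α)

/-- The unglued glued sum over a window is the sub-cube functional `ZKW`. [this work] -/
theorem gsum_empty_glue_eq_ZKW (W : Finset α) : F.gsum W ∅ ∅ ∅ = F.ZKW W := by
  unfold gsum ZKW
  rw [nested_eq_sum_filter]
  unfold partsOf
  refine sum_congr rfl fun q _ => ?_
  rw [union_empty, union_empty, union_empty]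

/-- **★ₖ when the non-bottom-module core has at most five points**: `univ = W₀ ⊔ ⨆ M i` with pairwise disjoint modules `M i` (`lab (M i) ≠ 0`) and `#W₀ ≤ 5` imply `0 ≤ ZK`.
[this work] -/
theorem ZK_nonneg_of_modules_core_card_le_five [Fintype α] {ι : Type*} [DecidableEq ι] (W₀ : Finset α) (hW₀ : W₀.card ≤ 5)
    (s : Finset ι) (M : ι → Finset α) (g : ι → (Finset α → Bool))
    (hmod : ∀ i ∈ s, F.IsModule (M i) (g i)) (hlab : ∀ i ∈ s, F.lab (M i) ≠ 0)
    (hdisj : ∀ i ∈ s, ∀ j ∈ s, i ≠ j → Disjoint (M i) (M j)) (h0disj : ∀ i ∈ s, Disjoint W₀ (M i))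
    (hcov : W₀ ∪ s.biUnion M = univ) : 0 ≤ F.ZK := by
  refine F.ZK_nonneg_of_core_and_modules W₀ s M g hmod hlab hdisj h0disj hcov ?_
  rw [F.gsum_empty_glue_eq_ZKW]
  exact F.ZKW_nonneg_of_card_le_five W₀ hW₀

end MSunflower

end Summit.CriticalPhenomena.PercolationContinuityZ3.Theorems.SunflowerPartition
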